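import Summits.ResolutionOfSingularities.ResolutionOfSingularities.Theses.WildQuotients
import Summits.ResolutionOfSingularities.ResolutionOfSingularities.Theorems.PAlterationPicoverGiraudSepReduction
import Literature.AlgebraicGeometry.Resolution.LogRegularResolutionGeneralHolds
import HarnessLib

/-!
# Item `GiraudModelResolves` (stmt-ResolutionOfSingularities-18002, route `WildQuotients`) — PROVED

Child 2 of the Giraud split of crux `Picover` (stmt-0554; package `Cruxes/Picover/SPLIT-giraud.md`,
strategist s2 after lead a3): for `W` integral, separated, of finite type over a field `k` of
characteristic `p`, `L/K(W)` purely inseparable of degree `p`, a proper birational `ρ : W' → W` with `W'`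
integral regular, an snc boundary `E` on `W'`, `L` a `K(W')`-algebra compatibly with `ρ^♯`, and the class
of `L` in Giraud normal form along `E` locally uniformly on `W'` (affine neighbourhoods carrying a section
`a` representing the class whose germ at every point is `GiraudNormalFormAt`), the normalisation of `W'`
in `L` HAS A RESOLUTION OF SINGULARITIES.

Proof = the two halves of the endgame, both theorems of the tree:
* algebraic half — `Picover.GiraudSepReduction.endgameAtlasSep` (lead a3, 2026-08-17): the normalised
  cover `W'^L` itself carries a log regular Zariski fs atlas glued (Kato (1.5)(S)) from the local charts
  `localChartSep_woundCentre` / `localChartSep_kummerCentre` at wound-transversal resp. Kummer centres;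
* resolution half — Kato 1994 (10.4), atlas form, `Kato1994_logRegular_hasResolution_general_holds`
  (`Literature/AlgebraicGeometry/Resolution/LogRegularResolutionGeneralHolds.lean`, 2026-08-27: linked
  KKMS regular refinement of the face fans + scheme-side assembly; seat res-L0-w81-pv-2 g2 with
  res-lit-3 / res-type-037 / res-type-043) — the item's only literature debt, now discharged.

The conclusion of the item is written with Mathlib's relative normalisation of
`Spec L → Spec K(W') → W'`, which is `Literature.AlgebraicGeometry.Resolution.normalizationIn W' L` by
definition.  With child 2 proved, the split reads `GiraudNormalFormSep → Picover` (cf.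
`Theorems.picover_of_giraudNormalFormSep`, p529923); item 18001 (child 1) remains the open research content.
-/

noncomputable section

set_option linter.dupNamespace false -- mandated namespace of this single-conjunct summit

open CategoryTheory AlgebraicGeometry
open Literature.AlgebraicGeometry.Resolution

namespace Summit.ResolutionOfSingularities.ResolutionOfSingularities.Theorems

/-- **Item stmt-ResolutionOfSingularities-18002 `WildQuotients.GiraudModelResolves`, proved.** A
Giraud-normal-form model resolves the residue upstairs: under the data of the Giraud split (regular
proper birational model `W'` of `W` with snc boundary `E`, the degree-`p` purely inseparable class of
`L/K(W)` in `GiraudNormalFormAt` form along `E` locally uniformly), the normalisation of `W'` in `L` has a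
resolution — `endgameAtlasSep` (log regular Zariski fs atlas on `W'^L`) + Kato 1994 (10.4)
(`Kato1994_logRegular_hasResolution_general_holds`). [folklore] -/
theorem giraudModelResolves_proof :
    Summit.ResolutionOfSingularities.ResolutionOfSingularities.Theses.WildQuotients.GiraudModelResolves := by
  intro p hp k _ _ W _ f L _ _ W' _ ρ _ _ E _ _hsep hlft hqc hcompat hbir hW'reg hE hPI hdeg hNF
  haveI : Fact p.Prime := ⟨hp⟩
  haveI : LocallyOfFiniteType f := hlft
  haveI : QuasiCompact f := hqc
  haveI : FiniteDimensional W.functionField L :=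
    Module.finite_of_finrank_pos (by rw [hdeg]; exact hp.pos)
  -- algebraic half: a log regular Zariski fs atlas on a proper birational model of `W'^L`
  obtain ⟨Y', ν, hν, hνbir, ⟨atlas⟩⟩ :=
    Picover.GiraudSepReduction.endgameAtlasSep p k W f L W' ρ E hcompat hbir hW'reg hE hPI hdeg hNF
  haveI := hν
  -- resolution half: Kato 1994 (10.4), then down the proper birational `ν`
  have hres : Scheme.HasResolution (normalizationIn W' L) :=
    Scheme.HasResolution.of_isBirational ν hνbir
      (Kato1994_logRegular_hasResolution_general_holds.{0} Y' ⟨atlas⟩)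
  exact hres

end Summit.ResolutionOfSingularities.ResolutionOfSingularities.Theorems

end
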